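import Summits.ResolutionOfSingularities.ResolutionOfSingularities.Theorems.FrobeniusClosingPatchingRelPerfectConeDepthTwoCharts
import HarnessLib

/-!
# Crux `PatchingRelPerfect` (stmt-ResolutionOfSingularities-16161), chain w52 — the first
# NON-GRADED member: the TILTED cone `I = (x₀x₁ + x₂² + x₂x₃²) + 𝔪⁴` — chart ideals

[OURS · L1 W5.2 · rung] Kernel sentence v1.4/v1.6 (iii) (CHAIN.md §4) locates the cheapest open
content at NON-GRADED one-form members `f = F_e + F_{e+1}`, `F_{e+1} ∉ (F_e)`, of exceptional
depth two, «undecided by hand».  This file and its sequels kernel-check the first such member: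
`f = q + x₂x₃²`, `q = x₀x₁ + x₂²` the quadric CONE (`F₂ = q`, `F₃ = x₂x₃² ∉ (q)`, vanishing at
the vertex `z₀ = [0:0:0:1]`), `I = (f) + 𝔪⁴`.  On the vertex chart `B₃` of `Bl_𝔪` the residual is
`K = (q̃ + u e₂, u²)` — NOT `u`-graded (`u e₂ ∉ K`) — but still `K ≤ 𝔫_{z₀}²`, so the vertex is
weight-two-permissible, and after blowing it up the strict transform of `f` is the TILTED conic
`G♯ = G + u'e'₃` (`G = e'₁e'₂ + e'₃²`), congruent to `G` modulo the strict transform `u'` of the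
exceptional divisor: the depth-two cone tower of `…ConeDepthTwoCharts.lean` / `…ConeDepthTwo.lean`
(this seat, r2c) runs VERBATIM with `G♯` for `G` — same companion
`Q = (P + 𝔪²)(I + 𝔪²(P + 𝔪²)) · 𝔪`, same four regular centres.  Identities half, any ring:

* level one: `chartBase_qTilt` (`φ(f) = u² F♯`, `F♯ = F + u e₂e₃²`), `map_chartBase_I2t`,
  `map_chartBase_L't`, `map_chartBase_I2Qt`, `map_chartBase_I2Qt_of_ne_three`;
* level two: `chartBase_Ft_two` (`ψ(F + t v₂) = w² G♯`), `map_chartBase_LLt`, `map_chartBase_KKt`,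
  `map_chartBase_LKt`, `map_chartBase_LKt_zero`, `map_chartBase_LKt_succ`;
* the congruences `span_pair_tilt` (`(u', G♯) = (u', G)`), `Ft_sub_mem` (`F♯ - F ∈ (u)`).

FORMAT evidence for the core only; nothing here is a statement of the manuscript under review.

## References

* The Stacks Project, Tags 080A, 0804. [StacksProject]
* Q. Liu, *Algebraic Geometry and Arithmetic Curves*, OUP 2002, Thm. 8.1.19 (a). [Liu2002]
-/

-- `Summit.<Summit>.<Sub>.Theorems` with `Sub = Summit` (single-conjunct summit, D-0017)
set_option linter.dupNamespace false

noncomputable section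

open CategoryTheory CategoryTheory.Limits AlgebraicGeometry Literature.AlgebraicGeometry.Resolution
open IsLocalRing

namespace Summit.ResolutionOfSingularities.ResolutionOfSingularities.Theorems

namespace ConeRung

universe u

/-! ## Small ideal algebra -/

/-- `(a, b + a c) = (a, b)`. [folklore] -/
theorem span_pair_add_mul {A : Type*} [CommRing A] (a b c : A) :
    Ideal.span {a, b + a * c} = Ideal.span {a, b} := by
  apply le_antisymm
  · rw [Ideal.span_le]
    rintro y (rfl | rfl)
    · exact Ideal.subset_span (Or.inl rfl)
    · exact Ideal.mem_span_pair.mpr ⟨c, 1, by ring⟩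
  · rw [Ideal.span_le]
    rintro y (rfl | rfl)
    · exact Ideal.subset_span (Or.inl rfl)
    · exact Ideal.mem_span_pair.mpr ⟨-c, 1, by ring⟩

/-! ## Level one: `I = (f) + 𝔪⁴`, `f = x₀x₁ + x₂² + x₂x₃²`, on the Rees charts of `Bl_𝔪` -/

section LevelOne

variable {S : Type u} [CommRing S] (x : Fin 4 → S) (i : Fin 4)

local notation3 "M" => Ideal.span (Set.range x)
local notation3 "I2t" => Ideal.span {x 0 * x 1 + x 2 ^ 2 + x 2 * x 3 ^ 2} ⊔ Ideal.span (Set.range x) ^ 4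
local notation3 "PP" => Ideal.span {x 0, x 1, x 2}
local notation3 "φ" => chartBase x i
local notation3 "u" => chartBase x i (x i)
local notation3 "e[" j "]" => chartGen x i j
local notation3 "F" => chartGen x i 0 * chartGen x i 1 + chartGen x i 2 ^ 2
local notation3 "Ft" => chartGen x i 0 * chartGen x i 1 + chartGen x i 2 ^ 2 +
  chartBase x i (x i) * chartGen x i 2 * chartGen x i 3 ^ 2

/-- **`φ(f) = u² · F♯`**, `F♯ = e₀e₁ + e₂² + u e₂e₃²`, on every chart. [folklore] -/
theorem chartBase_qTilt : φ (x 0 * x 1 + x 2 ^ 2 + x 2 * x 3 ^ 2) = u ^ 2 * Ft := by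
  rw [map_add, chartBase_q, map_mul, map_pow, reesChartBase_apply_eq_mul_chartGen x i 2,
    reesChartBase_apply_eq_mul_chartGen x i 3]
  ring

/-- `F♯ - F ∈ (u)`. [folklore] -/
theorem Ft_sub_mem : Ft - F ∈ Ideal.span {u} := by
  rw [show Ft - F = u * (e[2] * e[3] ^ 2) by ring]
  exact Ideal.mul_mem_right _ _ (Ideal.subset_span rfl)

/-- `(u, F♯) = (u, F)`. [folklore] -/
theorem span_u_Ft : Ideal.span {u, Ft} = Ideal.span {u, F} := by
  have h : Ft = F + u * (e[2] * e[3] ^ 2) := by ring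
  rw [h]
  exact span_pair_add_mul _ _ _

/-- **`I B_i = u² · ((F♯) + (u²))`**. [folklore] -/
theorem map_chartBase_I2t :
    (I2t).map φ = Ideal.span {u} ^ 2 * (Ideal.span {Ft} ⊔ Ideal.span {u} ^ 2) := by
  rw [Ideal.map_sup, Ideal.map_pow, map_chartBase_M, Ideal.map_span, Set.image_singleton,
    chartBase_qTilt, span_pow_mul, Ideal.mul_sup, ← pow_add]

/-- **`(I + 𝔪² (P + 𝔪²)) B_i = u² · ((F♯) + u · (u, e₀, e₁, e₂))`**. [folklore] -/
theorem map_chartBase_L't :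
    (I2t ⊔ M ^ 2 * (PP ⊔ M ^ 2)).map φ =
      Ideal.span {u} ^ 2 *
        (Ideal.span {Ft} ⊔ Ideal.span {u} * Ideal.span {u, e[0], e[1], e[2]}) := by
  rw [Ideal.map_sup, map_chartBase_I2t, Ideal.map_mul, Ideal.map_pow, map_chartBase_M,
    map_chartBase_PM, ← Ideal.mul_sup, sup_assoc]
  have hle : Ideal.span {u} ^ 2 ≤ Ideal.span {u} * Ideal.span {u, e[0], e[1], e[2]} := by
    rw [sq]
    exact Ideal.mul_mono_right (Ideal.span_mono (Set.singleton_subset_iff.mpr (Set.mem_insert _ _)))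
  rw [sup_eq_right.mpr hle]

/-- **The total transform of `I · Q`** on every chart. [folklore] -/
theorem map_chartBase_I2Qt :
    (I2t * ((PP ⊔ M ^ 2) * (I2t ⊔ M ^ 2 * (PP ⊔ M ^ 2)))).map φ =
      Ideal.span {u ^ 5} *
        (((Ideal.span {Ft} ⊔ Ideal.span {u} * Ideal.span {u, e[0], e[1], e[2]}) *
            (Ideal.span {Ft} ⊔ Ideal.span {u} ^ 2)) *
          Ideal.span {u, e[0], e[1], e[2]}) := by
  rw [Ideal.map_mul, Ideal.map_mul, map_chartBase_I2t, map_chartBase_PM, map_chartBase_L't,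
    ← Ideal.span_singleton_pow]
  ring

/-- **On the charts `i = 0, 1, 2`: `(I Q) B_i = u⁵ · (u, F♯) · ((F♯) + (u²))`**. [folklore] -/
theorem map_chartBase_I2Qt_of_ne_three (hi : i ≠ 3) :
    (I2t * ((PP ⊔ M ^ 2) * (I2t ⊔ M ^ 2 * (PP ⊔ M ^ 2)))).map φ =
      Ideal.span {u ^ 5} * (Ideal.span {u, Ft} * (Ideal.span {Ft} ⊔ Ideal.span {u ^ 2})) := by
  rw [map_chartBase_I2Qt, span_u_e_eq_top_of_ne_three x i hi, Ideal.mul_top, Ideal.mul_top,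
    Ideal.span_insert u {Ft}, sup_comm (Ideal.span {u}) _, Ideal.span_singleton_pow]

end LevelOne

/-! ## Level two: `L = (F♯) + t (t, v)`, `K = (F♯) + (t²)`, `F♯ = v₀v₁ + v₂² + t v₂` -/

section LevelTwo

variable {A : Type u} [CommRing A] (t : A) (v : Fin 3 → A) (j : Fin 4)

local notation3 "cc" => (Fin.cons t v : Fin 4 → A)
local notation3 "F" => v 0 * v 1 + v 2 ^ 2
local notation3 "Ft" => v 0 * v 1 + v 2 ^ 2 + t * v 2
local notation3 "LLt" => Ideal.span {v 0 * v 1 + v 2 ^ 2 + t * v 2} ⊔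
  Ideal.span {t} * Ideal.span {t, v 0, v 1, v 2}
local notation3 "KKt" => Ideal.span {v 0 * v 1 + v 2 ^ 2 + t * v 2} ⊔ Ideal.span {t} ^ 2
local notation3 "ψ" => chartBase cc j
local notation3 "w" => chartBase cc j (cc j)
local notation3 "e'[" l "]" => chartGen cc j l
local notation3 "G" => chartGen cc j 1 * chartGen cc j 2 + chartGen cc j 3 ^ 2
local notation3 "Gt" => chartGen cc j 1 * chartGen cc j 2 + chartGen cc j 3 ^ 2 +
  chartGen cc j 0 * chartGen cc j 3

/-- `F♯ - F ∈ (t)`. [folklore] -/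
theorem Ft_sub_mem_two : Ft - F ∈ Ideal.span {t} := by
  rw [show Ft - F = t * v 2 by ring]
  exact Ideal.mul_mem_right _ _ (Ideal.subset_span rfl)

/-- **`ψ(F♯) = w² G♯`**, `G♯ = G + u' e'₃` (the TILTED conic), on every chart of `Bl_{(c)}`.
[folklore] -/
theorem chartBase_Ft_two : ψ Ft = w ^ 2 * Gt := by
  have h3 : ψ (v 2) = w * e'[3] := reesChartBase_apply_eq_mul_chartGen cc j 3
  rw [map_add, chartBase_F_two, map_mul, chartBase_t_two, h3]
  ring

/-- `(u', G♯) = (u', G)`. [folklore] -/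
theorem span_pair_tilt : Ideal.span {e'[0], Gt} = Ideal.span {e'[0], G} := by
  have h : Gt = G + e'[0] * e'[3] := by ring
  rw [h]
  exact span_pair_add_mul _ _ _

/-- **`L C_j = w² · ((G♯) + (u'))`**. [folklore] -/
theorem map_chartBase_LLt :
    (LLt).map ψ = Ideal.span {w} ^ 2 * (Ideal.span {Gt} ⊔ Ideal.span {e'[0]}) := by
  rw [Ideal.map_sup, Ideal.map_mul, Ideal.map_span, Set.image_singleton, chartBase_Ft_two,
    Ideal.map_span, Set.image_singleton, chartBase_t_two, map_chartBase_span_t_v, span_pow_mul,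
    ← Ideal.span_singleton_mul_span_singleton, mul_assoc, mul_comm (Ideal.span {e'[0]}),
    ← mul_assoc, ← sq, ← Ideal.mul_sup]

/-- **`K C_j = w² · ((G♯) + (u'²))`**. [folklore] -/
theorem map_chartBase_KKt :
    (KKt).map ψ = Ideal.span {w} ^ 2 * (Ideal.span {Gt} ⊔ Ideal.span {e'[0] ^ 2}) := by
  rw [Ideal.map_sup, Ideal.map_pow, Ideal.map_span, Set.image_singleton, chartBase_Ft_two,
    Ideal.map_span, Set.image_singleton, chartBase_t_two, span_pow_mul,
    ← Ideal.span_singleton_mul_span_singleton, mul_pow, ← Ideal.mul_sup,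
    Ideal.span_singleton_pow (chartGen cc j 0) 2]

/-- **The total transform of `L · K`**: `(L K) C_j = w⁴ · ((u', G♯) · ((G♯) + (u'²)))`.
[folklore] -/
theorem map_chartBase_LKt :
    (LLt * KKt).map ψ =
      Ideal.span {w ^ 4} * (Ideal.span {e'[0], Gt} * (Ideal.span {Gt} ⊔ Ideal.span {e'[0] ^ 2})) := by
  rw [Ideal.map_mul, map_chartBase_LLt, map_chartBase_KKt, mul_mul_mul_comm, span_sq_mul_span_sq,
    Ideal.span_insert (chartGen cc j 0), sup_comm (Ideal.span {e'[0]})]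

/-- **On the `t`-chart everything is Cartier**: `(L K) C₀ = (w⁴)`. [folklore] -/
theorem map_chartBase_LKt_zero :
    (LLt * KKt).map (chartBase cc 0) = Ideal.span {chartBase cc 0 (cc 0) ^ 4} := by
  rw [map_chartBase_LKt]
  have h1 : chartGen cc 0 0 = 1 := chartGen_self cc 0
  have hu : IsUnit (chartGen cc 0 0) := by rw [h1]; exact isUnit_one
  have htop : Ideal.span {chartGen cc 0 0,
      chartGen cc 0 1 * chartGen cc 0 2 + chartGen cc 0 3 ^ 2 + chartGen cc 0 0 * chartGen cc 0 3} = ⊤ :=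
    Ideal.eq_top_of_isUnit_mem _ (Ideal.subset_span (Or.inl rfl)) hu
  have htop' : Ideal.span {chartGen cc 0 0 ^ 2} = ⊤ :=
    Ideal.eq_top_of_isUnit_mem _ (Ideal.subset_span rfl) (hu.pow 2)
  rw [htop, htop', sup_top_eq, Ideal.top_mul, Ideal.mul_top]

/-- **On the `v_k`-chart**: `(L K) C_j = w⁴ · ∏_{k<2} ((G♯) + (u', G♯)ᵏ⁺¹)` — the two-step tower
for the pair `(u', G♯)`. [folklore] -/
theorem map_chartBase_LKt_succ (k : Fin 3) :
    (LLt * KKt).map (chartBase cc (Fin.succ k)) =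
      Ideal.span {chartBase cc (Fin.succ k) (cc (Fin.succ k)) ^ 4} *
        ∏ l ∈ Finset.range 2,
          (Ideal.span (Set.range ((Fin.cons (chartGen cc (Fin.succ k) 0)
              (fun _ : Fin 1 => chartGen cc (Fin.succ k) 1 * chartGen cc (Fin.succ k) 2 +
                chartGen cc (Fin.succ k) 3 ^ 2 + chartGen cc (Fin.succ k) 0 * chartGen cc (Fin.succ k) 3) :
                  Fin 2 → chartRing cc (Fin.succ k)) ∘
              (fun _ : Fin 1 => (1 : Fin 2)))) ⊔
            Ideal.span (Set.range (Fin.cons (chartGen cc (Fin.succ k) 0)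
              (fun _ : Fin 1 => chartGen cc (Fin.succ k) 1 * chartGen cc (Fin.succ k) 2 +
                chartGen cc (Fin.succ k) 3 ^ 2 + chartGen cc (Fin.succ k) 0 * chartGen cc (Fin.succ k) 3) :
                  Fin 2 → chartRing cc (Fin.succ k))) ^ (l + 1)) := by
  rw [CoreRungTower.towerTwo_eq, map_chartBase_LKt]

end LevelTwo

end ConeRung

end Summit.ResolutionOfSingularities.ResolutionOfSingularities.Theorems

end
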